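import Mathlib
import HarnessLib

/-!
# The socle bound `dim_k V ≤ dim_k A · dim_k V[𝔪_A]` (crux `ProModularOfGKBound`, helper)

Route `EisensteinGelfandKirillov`, crux stmt-Langlands-18273 (`ProModularOfGKBound`).  Kernel-checked form of
the finite-level avatar of "total ≤ base + special fibre" that the crux idea card `gk-additivity` (crux-ideate
r1, ideator 2, first lemma `finrank_le_finrank_alg_mul_finrank_torsion`) isolates: for a finite-dimensional
`k`-vector space `V` (intended: `S(U^p K_r, k)_𝔪`) carrying a compatible action of a finite-dimensional
commutative LOCAL `k`-algebra `A` (intended: the image of the Hecke algebra), the `𝔪_A`-torsion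
`W = V[𝔪_A]` controls the size of `V`:

  `finrank k V ≤ finrank k A * finrank k W`.

Proof (injective-hull argument made elementary): choose a `k`-linear retraction `π : V → W` and map
`Φ : V → Hom_k(A, W)`, `v ↦ (a ↦ π (a • v))`.  The kernel of `Φ` is `A`-stable, and `𝔪_A` is nilpotent
(`A` is Artinian local), so a descending induction on the power of `𝔪_A` killing a kernel vector shows the
kernel is zero: a kernel vector killed by `𝔪_A` lies in `W`, where `Φ v 1 = π v = v`.  Hence
`dim V ≤ dim Hom_k(A, W) = dim A · dim W`.  Pure linear algebra; it supports the crux item, it does not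
close it.  (With the door `dim S_r[𝔪] ≤ C p^{r[F:ℚ]}` and `dim S_{r,𝔪} ≍ p^{3r[F:ℚ]}` the card reads off
`dim_k 𝕋_{r,𝔪} ≥ c p^{2r[F:ℚ]}`.)

References: standard (Matlis duality / injective hulls over Artinian local rings, e.g. Bruns–Herzog,
*Cohen–Macaulay rings*, §3.2). [folklore]
-/

set_option linter.dupNamespace false -- `Summit.Langlands.Langlands.Theorems` is the mandated Theorems namespace (summit = problem name)

namespace Summit.Langlands.Langlands.Theorems

open Module IsLocalRing

/-- **Socle bound.**  For a finite-dimensional `k`-space `V` with a compatible module structure over a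
finite-dimensional commutative local `k`-algebra `A`, and `W = V[𝔪_A]` the subspace killed by the maximal
ideal, `finrank k V ≤ finrank k A * finrank k W` (`V` embeds `k`-linearly into `Hom_k(A, W)`). [folklore] -/
theorem finrank_le_finrank_mul_finrank_torsion {k V A : Type*} [Field k] [AddCommGroup V]
    [Module k V] [FiniteDimensional k V]
    [CommRing A] [Algebra k A] [IsLocalRing A] [Module A V] [IsScalarTower k A V]
    [FiniteDimensional k A]
    (W : Submodule k V) (hW : ∀ v, v ∈ W ↔ ∀ a ∈ maximalIdeal A, a • v = 0) :
    finrank k V ≤ finrank k A * finrank k W := by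
  -- a `k`-linear retraction onto `W`
  obtain ⟨π, hπ⟩ := LinearMap.exists_leftInverse_of_injective W.subtype (Submodule.ker_subtype W)
  -- `Φ v = (a ↦ π (a • v))`
  let Φ : V →ₗ[k] A →ₗ[k] W :=
    LinearMap.mk₂ k (fun v a => π (a • v))
      (fun v w a => by simp only [smul_add, map_add])
      (fun c v a => by simp only [smul_comm a c v, map_smul])
      (fun v a b => by simp only [add_smul, map_add])
      (fun c v a => by simp only [smul_assoc, map_smul])
  have hΦ : ∀ v a, Φ v a = π (a • v) := fun v a => rfl
  -- the maximal ideal is nilpotent (`A` is Artinian local)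
  haveI : IsArtinianRing A := IsArtinianRing.of_finite k A
  obtain ⟨N, hN⟩ := IsArtinianRing.isNilpotent_jacobson_bot (R := A)
  rw [jacobson_eq_maximalIdeal ⊥ bot_ne_top] at hN
  -- descending induction: a kernel vector killed by `𝔪^j` is zero
  have key : ∀ j : ℕ, ∀ v : V, Φ v = 0 → (∀ x ∈ maximalIdeal A ^ j, x • v = 0) → v = 0 := by
    intro j
    induction j with
    | zero =>
      intro v _ hv
      simpa using hv 1 (by simp)
    | succ j ih =>
      intro v hv hkill
      -- every `a ∈ 𝔪` kills `v`
      have hav : ∀ a ∈ maximalIdeal A, a • v = 0 := by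
        intro a ha
        refine ih (a • v) ?_ fun x hx => ?_
        · ext b
          rw [hΦ, LinearMap.zero_apply, ← mul_smul, ← hΦ, hv, LinearMap.zero_apply]
        · rw [← mul_smul]
          exact hkill _ (by rw [pow_succ]; exact Ideal.mul_mem_mul hx ha)
      -- so `v ∈ W`, where `Φ v 1 = π v = v`
      have hvW : v ∈ W := (hW v).2 hav
      have h1 : Φ v 1 = ⟨v, hvW⟩ := by
        rw [hΦ, one_smul]
        exact LinearMap.congr_fun hπ ⟨v, hvW⟩
      rw [hv, LinearMap.zero_apply] at h1
      exact congrArg Subtype.val h1.symm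
  have hinj : Function.Injective Φ := by
    rw [← LinearMap.ker_eq_bot, LinearMap.ker_eq_bot']
    intro v hv
    exact key N v hv fun x hx => by
      rw [hN] at hx
      rw [(Submodule.mem_bot A).1 hx, zero_smul]
  calc finrank k V ≤ finrank k (A →ₗ[k] W) := LinearMap.finrank_le_finrank_of_injective hinj
    _ = finrank k A * finrank k W := Module.finrank_linearMap k k A W

end Summit.Langlands.Langlands.Theorems
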